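import Summits.NavierStokesRegularity.NavierStokesRegularity.Theses.ExtremiserTransience
import Summits.NavierStokesRegularity.NavierStokesRegularity.Theorems.ExtremiserTransienceNearExtremalTransienceCanonical
import HarnessLib

/-!
# Route `ExtremiserTransience`, crux `NearExtremalTransience` (stmt-NavierStokesRegularity-21883):
# THE CANONICAL FORM OF THE CRUX — a statement about the stretching efficiency `R(t)` itself

`--supports stmt-NavierStokesRegularity-21883`. Author: prover seat `ns-et-p1-g0`.

`nearExtremalTransience_iff_canonical`: the crux (∃ universal `θ < 1` such that for every universal depletion
constant `κ` every Type-I singular classical Leray–Hopf rapidly-decaying-datum flow carries SOME measurable flow-wise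
coefficient `k ∈ [0,1]` with `∫_{t₁}^t k²/(T−τ) ≤ (θκ)² log((T−t₁)/(T−t)) + B`) is EQUIVALENT to: ∃ universal
`θ < 1` such that along every such flow EVERY minimal measurable coefficient `k₀ ∈ [0,1]` (flow-wise clause on all
of `[0,T)`, pointwise below every admissible constant — by
`DepletionLadder.exists_canonical_coefficient` such a `k₀` exists and is the efficiency
`R(t) = |∫⟪ω, Du ω⟫| / (sup|u(t)|·‖ω(t)‖₂·‖∇ω(t)‖₂)`) satisfies the same log-mean bound from some onset.
(`→`: a minimal `k₀` is below the crux's `k` on `[t₁,T)` and the interval integral is monotone; `←`: take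
`k = k₀`.) So refuting / proving the crux is refuting / proving a log-time quadratic-mean bound on `R(t)` along
Type-I singular flows — nothing else. WHAT THIS IS NOT: no bound on `R(t)` beyond the landed constants is proved;
the crux, the route and the summit stay open. [folklore]
-/

noncomputable section

open Set Filter Topology MeasureTheory
open scoped InnerProductSpace RealInnerProductSpace ENNReal NNReal ContDiff
open Literature.Analysis.FluidPDE

namespace Summit.NavierStokesRegularity.NavierStokesRegularity.Theorems

-- the problem directory repeats the summit name (`NavierStokesRegularity/NavierStokesRegularity`)
set_option linter.dupNamespace false

open DepletionLadder

/-- **Canonical form of the crux `NearExtremalTransience` (stmt-NavierStokesRegularity-21883).** The crux holds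
iff there is a universal `θ ∈ [0,1)` such that for every universal depletion constant `κ`, every Type-I singular
classical Leray–Hopf rapidly-decaying-datum flow on `[0,T)` and EVERY measurable `k₀ : ℝ → [0,1]` satisfying
the flow-wise clause on `[0,T)` and minimal there (below every admissible constant at each time), there are an
onset `t₁ ∈ [0,T)` and `B` with `∫_{t₁}^t k₀²/(T−τ) ≤ (θκ)² log((T−t₁)/(T−t)) + B` for all `t ∈ [t₁,T)`.
The minimal coefficient is the stretching efficiency (`DepletionLadder.exists_canonical_coefficient`).
[folklore] -/
theorem nearExtremalTransience_iff_canonical :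
    Summit.NavierStokesRegularity.NavierStokesRegularity.Theses.ExtremiserTransience.NearExtremalTransience ↔
    (∃ θ : ℝ, 0 ≤ θ ∧ θ < 1 ∧ ∀ κ : ℝ, (∀ (v : EuclideanSpace ℝ (Fin 3) → EuclideanSpace ℝ (Fin 3)) (M B : ℝ), ContDiff ℝ (⊤ : ℕ∞) v → Literature.Analysis.FluidPDE.VectorCalculus.IsDivFree v → (∀ x, ‖v x‖ ≤ M) → (∀ x, ‖fderiv ℝ v x‖ ≤ B) → (∫⁻ x, ‖iteratedFDeriv ℝ 0 v x‖ₑ ^ 2 < ⊤) → (∫⁻ x, ‖iteratedFDeriv ℝ 1 v x‖ₑ ^ 2 < ⊤) → (∫⁻ x, ‖iteratedFDeriv ℝ 2 v x‖ₑ ^ 2 < ⊤) → |∫ x, ⟪Literature.Analysis.FluidPDE.curl v x, fderiv ℝ v x (Literature.Analysis.FluidPDE.curl v x)⟫_ℝ| ≤ κ * M * Real.sqrt (∫ x, ‖Literature.Analysis.FluidPDE.curl v x‖ ^ 2) * Real.sqrt (∫ x, Literature.Analysis.FluidPDE.frobeniusNormSq (fderiv ℝ (Literature.Analysis.FluidPDE.curl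 v) x))) → ∀ (C ν T : ℝ), 0 < C → 0 < ν → 0 < T → ∀ (u : ℝ → EuclideanSpace ℝ (Fin 3) → EuclideanSpace ℝ (Fin 3)) (p : ℝ → EuclideanSpace ℝ (Fin 3) → ℝ), Literature.Analysis.FluidPDE.IsClassicalNSSolutionOn (Set.Ico 0 T) ν 0 u p → Literature.Analysis.FluidPDE.IsLerayHopfOn T ν 0 (u 0) u → Literature.Analysis.FluidPDE.HasRapidSpatialDecay (u 0) → (∀ᶠ t in 𝓝[<] T, ∀ x, Real.sqrt (T - t) * ‖u t x‖ ≤ C * Real.sqrt ν) → ¬ Literature.Analysis.FluidPDE.HasSmoothExtensionPast ν 0 u T → ∀ k₀ : ℝ → ℝ, Measurable k₀ → (∀ τ, 0 ≤ k₀ τ ∧ k₀ τ ≤ 1) → (∀ t ∈ Set.Ico 0 T, ∀ M : ℝ, (∀ x, ‖u t x‖ ≤ M) → |∫ x, ⟪Literature.Analysis.FluidPDE.curl (u t) x, fderiv ℝ (u t) x (Literature.Analysis.FluidPDE.curl (u t) x)⟫_ℝ| ≤ k₀ t * M * Real.sqrt (∫ x, ‖Literature.Analysis.FluidPDE.curl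 (u t) x‖ ^ 2) * Real.sqrt (∫ x, Literature.Analysis.FluidPDE.frobeniusNormSq (fderiv ℝ (Literature.Analysis.FluidPDE.curl (u t)) x))) → (∀ t ∈ Set.Ico 0 T, ∀ c : ℝ, 0 ≤ c → (∀ M : ℝ, (∀ x, ‖u t x‖ ≤ M) → |∫ x, ⟪Literature.Analysis.FluidPDE.curl (u t) x, fderiv ℝ (u t) x (Literature.Analysis.FluidPDE.curl (u t) x)⟫_ℝ| ≤ c * M * Real.sqrt (∫ x, ‖Literature.Analysis.FluidPDE.curl (u t) x‖ ^ 2) * Real.sqrt (∫ x, Literature.Analysis.FluidPDE.frobeniusNormSq (fderiv ℝ (Literature.Analysis.FluidPDE.curl (u t)) x))) → k₀ t ≤ c) → ∃ t₁ ∈ Set.Ico 0 T, ∃ B : ℝ, ∀ t ∈ Set.Ico t₁ T, ∫ τ in t₁..t, k₀ τ ^ 2 / (T - τ) ≤ (θ * κ) ^ 2 * Real.log ((T - t₁) / (T - t)) + B) := by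
  constructor
  · rintro ⟨θ, hθ0, hθ1, H⟩
    refine ⟨θ, hθ0, hθ1, fun κ hκ C ν T hC hν hT u p hsol hLH hdec hrate hext k₀ hk₀m hk₀01 hcl hmin => ?_⟩
    obtain ⟨t₁, ht₁, k, B, hkm, hk01, hflow, hmean⟩ := H κ hκ C ν T hC hν hT u p hsol hLH hdec hrate hext
    refine ⟨t₁, ht₁, B, fun t ht => le_trans ?_ (hmean t ht)⟩
    refine intervalIntegral.integral_mono_on ht.1
      (intervalIntegrable_coeff_sq_div hk₀m hk₀01 ht.1 ht.2) (intervalIntegrable_coeff_sq_div hkm hk01 ht.1 ht.2)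
      fun τ hτ => ?_
    have hτ' : τ ∈ Set.Ico t₁ T := ⟨hτ.1, lt_of_le_of_lt hτ.2 ht.2⟩
    have hle : k₀ τ ≤ k τ :=
      hmin τ ⟨ht₁.1.trans hτ'.1, hτ'.2⟩ (k τ) (hk01 τ).1 (hflow τ hτ')
    exact div_le_div_of_nonneg_right (pow_le_pow_left₀ (hk₀01 τ).1 hle 2) (sub_pos.2 hτ'.2).le
  · rintro ⟨θ, hθ0, hθ1, H⟩
    refine ⟨θ, hθ0, hθ1, fun κ hκ C ν T hC hν hT u p hsol hLH hdec hrate hext => ?_⟩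
    obtain ⟨k₀, hk₀m, hk₀01, hcl, hmin⟩ := exists_canonical_coefficient hν hT hsol hLH hdec
    obtain ⟨t₁, ht₁, B, hmean⟩ :=
      H κ hκ C ν T hC hν hT u p hsol hLH hdec hrate hext k₀ hk₀m hk₀01 hcl hmin
    exact ⟨t₁, ht₁, k₀, B, hk₀m, hk₀01, fun t ht => hcl t ⟨ht₁.1.trans ht.1, ht.2⟩, hmean⟩

end Summit.NavierStokesRegularity.NavierStokesRegularity.Theorems

end
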